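/-
Origin: expansion seat `planner-pub-hodgecm-qw8-g11-0`, handover #20 SPLIT PART 1/4 of tree `HodgeCM/Model/Toy/LefQuartic.lean` 7081025a (1140 l. > 400-line cap) = NEW module `HodgeCM.Model.Toy.LefQuarticSign` md5 009d5519b5812fc4b9e7c066f35bc4a7 (363 l.): verbatim section-boundary slice + docstrings; imports: NO rewrite (tree imports only: Mathlib, HodgeCM.Model.Toy.LefDegree4); check-wip LANDABLE rc 0 / 0 warnings / 0 proof-hole; lean -DautoImplicit=false rc 0; fr (`HOME/pub-hodgecm-qw8-g11/lean/Qw8g11/LefQuarticSign.lean`, md5 009d5519, 363 lines);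
landed by the packager successor (mc-unitary-1-g3, gen-8 kit) in gate run 32 as `HodgeCM/Model/Toy/LefQuarticSign.lean` (verbatim).
-/
-- HANDOVER (planner-pub-hodgecm-qw8-g11-0, unit pub-hodgecm-qw8-g11): SPLIT PART 1/4 of the installed
-- `HodgeCM.Model.Toy.LefQuartic` (md5 7081025a, 1140 l.; 400-line cap, lean/CONVENTIONS.md) = its §§1–4 (ll. 76–375) verbatim +
-- docstrings; WIP module `Qw8g11.LefQuarticSign`, intended final module `HodgeCM.Model.Toy.LefQuarticSign` (NEW file; tree
-- imports only, NO rewrite). Parts: LefQuarticSign → LefQuarticTwist → LefQuarticInner → LefQuartic (import chain).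
/-
Copyright: pub-hodgecm cell (HodgeCMPerL). Separating-model layer (gen 8 of the [QW8] §2.5 lineage). New file.
-/
import Mathlib
import Summits.HodgeConjecture.HodgeCM.Model.Toy.LefDegree4

/-!
# The Lefschetz model in CM degree at most four, I: holomorphy counts, the Galois twist, signs

Split part 1/4 of `HodgeCM.Model.Toy.LefQuartic` (its §§1–4, unchanged; the headline and the overview of the whole proof
are in the module docstring of `HodgeCM.Model.Toy.LefQuartic`).

* §1 (any object, any degree) `Obj.hodgeClasses_bal_of_cntBal`: a RATIONAL class of Hodge type `(p,p)` has non-zero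
  wedge-basis coordinates only at index sets `S` all of whose Galois translates `γ • S` have exactly `p` holomorphic slots
  (`Obj.cnt_gact_eq_of_repr_ne_zero`); hence `Hdg^{2p} ⊆ Θ⁻¹ Bal^{2p}` as soon as `X.CntBal` := "constant holomorphy count under
  Galois ⇒ balanced" — the generalisation of the model's Lefschetz (1,1) (`Obj.lefschetz11_bal`) to all degrees.
* §2 the Galois twist `twist γ σ` on the embeddings of one field: action laws, and the twist on a CM field commutes with
  complex conjugation (`twist_conjugate`).
* §3 signs `sgn_Ψ(φ) = ±1` of embeddings relative to a CM type, and the embeddings of a CM field of degree `≤ 4`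
  (`eq_or_of_finrank_eq_two`, `finrank_eq_two_or_eq_four_of_le_four`, …).
* §4 sign vectors: `±1`-valued functions with extremal inner product agree (or are opposite).

Nothing here is cited: kernel facts about an explicit model.
-/

noncomputable section

set_option backward.isDefEq.respectTransparency false

namespace HodgeCM.Toy

open scoped TensorProduct
open exteriorPower Module CMPresentation CMTypeOps
open NumberField.ComplexEmbedding (conjugate)
open Literature.AlgebraicGeometry.Motives
open Literature.AlgebraicGeometry.Motives.HodgeStructure (ofRat ofRat_apply mem_hodgeClasses_iff)
open Literature.AlgebraicGeometry.ShimuraVarieties (conjRingHomK embedding_conjRingHomK)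

/-! ### 1. Hodge classes are supported on index sets of Galois-constant holomorphy count -/

namespace Obj

variable (X : Obj)

/-- `X.CntBal`: every injective index map ALL of whose Galois translates have the same number of holomorphic
slots is balanced.  (§8 proves it for every object presented over one quartic CM field.) -/
def CntBal : Prop :=
  ∀ ⦃k : ℕ⦄ (g : Fin k → X.Idx), Function.Injective g →
    (∀ γ δ : Gam, X.cnt (fun i => X.gact γ (g i)) = X.cnt (fun i => X.gact δ (g i))) → X.Bal g

/-- **support of a rational `(p, ·)`-class**: if the image under `Θ` of a RATIONAL `k`-class lies in
`FF k p ⊓ GG k (p+1)` (i.e. in `H^{p, k-p}`), then at every wedge-basis vector `e_S` where its coordinate is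
non-zero, ALL Galois translates `γ • S` have exactly `p` holomorphic slots (Galois moves the coordinates:
`LefLefschetz.D_theta_gact`). -/
theorem cnt_gact_eq_of_repr_ne_zero {k : ℕ} {p : ℤ} (x : ↥(⋀[ℚ]^k X.L))
    (hF : X.Θ k ((1 : ℂ) ⊗ₜ[ℚ] x) ∈ X.FF k p) (hG : X.Θ k ((1 : ℂ) ⊗ₜ[ℚ] x) ∈ X.GG k (p + 1))
    {S : Set.powersetCard X.Idx k}
    (hc : (X.eB.exteriorPower k).repr (X.Θ k ((1 : ℂ) ⊗ₜ[ℚ] x)) S ≠ 0) (γ : Gam) :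
    (X.cnt (fun i => X.gact γ ((Set.powersetCard.ofFinEmbEquiv.symm S) i)) : ℤ) = p := by
  rw [basis_repr_eq_D] at hc
  obtain ⟨z, hz, hγz⟩ := X.D_theta_gact (fun i => (Set.powersetCard.ofFinEmbEquiv.symm S) i) γ x
  have hz0 : z ≠ 0 := fun h0 => hc (by rw [← hz, h0, ZeroMemClass.coe_zero])
  have hγz0 : γ z ≠ 0 := (EmbeddingLike.map_ne_zero_iff).mpr hz0
  have hne : X.D (fun i => X.gact γ ((Set.powersetCard.ofFinEmbEquiv.symm S) i))
      (X.Θ k ((1 : ℂ) ⊗ₜ[ℚ] x)) ≠ 0 := by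
    rw [← hγz]
    exact fun h => hγz0 (ZeroMemClass.coe_eq_zero.mp h)
  have hinjγ : Function.Injective (fun i => X.gact γ ((Set.powersetCard.ofFinEmbEquiv.symm S) i)) :=
    (X.gact_injective γ).comp (Set.powersetCard.ofFinEmbEquiv.symm S).injective
  have h1 : ¬ ((X.cnt (fun i => X.gact γ ((Set.powersetCard.ofFinEmbEquiv.symm S) i)) : ℤ) < p) :=
    fun hlt => hne (X.D_eq_zero_of_mem_FF hinjγ hlt hF)
  have h2 : ¬ (p + 1 ≤ (X.cnt (fun i => X.gact γ ((Set.powersetCard.ofFinEmbEquiv.symm S) i)) : ℤ)) :=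
    fun hle => hne (X.D_eq_zero_of_mem_GG hinjγ hle hG)
  omega

/-- **balanced support**: under `CntBal`, the `Θ`-image of a rational class in `FF k p ⊓ GG k (p+1)` lies in
the balanced span `Balᵏ` (generalises `Obj.theta_mem_balSpan_two`, the case `k = 2`, `p = 1`). -/
theorem theta_mem_balSpan_of_cntBal (hX : X.CntBal) {k : ℕ} {p : ℤ} (x : ↥(⋀[ℚ]^k X.L))
    (hF : X.Θ k ((1 : ℂ) ⊗ₜ[ℚ] x) ∈ X.FF k p) (hG : X.Θ k ((1 : ℂ) ⊗ₜ[ℚ] x) ∈ X.GG k (p + 1)) :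
    X.Θ k ((1 : ℂ) ⊗ₜ[ℚ] x) ∈ X.balSpan k := by
  rw [← (X.eB.exteriorPower k).sum_repr (X.Θ k ((1 : ℂ) ⊗ₜ[ℚ] x))]
  refine Submodule.sum_mem _ fun S _ => ?_
  by_cases hc : (X.eB.exteriorPower k).repr (X.Θ k ((1 : ℂ) ⊗ₜ[ℚ] x)) S = 0
  · rw [hc, zero_smul]; exact zero_mem _
  refine Submodule.smul_mem _ _ ?_
  rw [basis_eq_mono]
  apply X.mono_mem_balSpan
  refine hX _ (Set.powersetCard.ofFinEmbEquiv.symm S).injective fun γ δ => ?_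
  have h := X.cnt_gact_eq_of_repr_ne_zero x hF hG hc γ
  have h' := X.cnt_gact_eq_of_repr_ne_zero x hF hG hc δ
  omega

/-- **Hodge classes of every degree have balanced support under `CntBal`** (generalises Lefschetz (1,1) in
the model, `Obj.lefschetz11_bal`): `Hdg^{2p} ⊆ Θ⁻¹ Bal^{2p}`. -/
theorem hodgeClasses_bal_of_cntBal (hX : X.CntBal) (p : ℕ) (x : ↥(⋀[ℚ]^(2 * p) X.L))
    (hx : x ∈ (X.hodgeStructure (2 * p)).hodgeClasses p) :
    X.Θ (2 * p) ((1 : ℂ) ⊗ₜ[ℚ] x) ∈ X.balSpan (2 * p) := by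
  have hp := HodgeStructure.ofRat_mem_piece_of_mem_hodgeClasses (X.hodgeStructure (2 * p)) (p := p)
    (by push_cast; ring) hx
  rw [HodgeStructure.piece_of_add_eq _ (by push_cast; ring), Submodule.mem_inf] at hp
  obtain ⟨hF, hG⟩ := hp
  have hG' : HodgeStructure.ofRat x ∈ (X.GG (2 * p) (p + 1)).comap (X.Θ (2 * p)).toLinearMap := by
    rw [← X.complexConj_hodgeF (2 * p) (p + 1) p (by push_cast; ring)]
    exact hG
  exact X.theta_mem_balSpan_of_cntBal hX x hF hG'

end Obj

/-! ### 2. The Galois twist on the embeddings of one field: action laws -/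

section Twist

variable {K : Type} [Field K] [NumberField K]

/-- the `ℚ̄`-valued lift of the twisted embedding `γ • σ` is `γ ∘ liftK σ` -/
theorem liftK_twist (γ : Gam) (σ : K →+* ℂ) (x : K) : liftK (twist γ σ) x = γ (liftK σ x) :=
  Subtype.ext rfl

/-- `1 • σ = σ` -/
theorem twist_one (σ : K →+* ℂ) : twist 1 σ = σ :=
  RingHom.ext fun x => by rw [twist_apply, AlgEquiv.one_apply, coe_liftK]

/-- `(γδ) • σ = γ • (δ • σ)` -/
theorem twist_mul (γ δ : Gam) (σ : K →+* ℂ) : twist (γ * δ) σ = twist γ (twist δ σ) :=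
  RingHom.ext fun x => by rw [twist_apply, twist_apply, AlgEquiv.mul_apply, liftK_twist]

/-- `γ⁻¹ • (γ • σ) = σ` -/
theorem twist_symm_twist (γ : Gam) (σ : K →+* ℂ) : twist γ.symm (twist γ σ) = σ :=
  RingHom.ext fun x => by rw [twist_apply, liftK_twist, AlgEquiv.symm_apply_apply, coe_liftK]

/-- twisting by `γ` is injective on `Hom(K, ℂ)` -/
theorem twist_injective (γ : Gam) : Function.Injective (twist γ : (K →+* ℂ) → (K →+* ℂ)) :=
  fun σ τ h => by rw [← twist_symm_twist γ σ, ← twist_symm_twist γ τ, h]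

/-- complex conjugation `κ ∈ Gal(ℚ̄/ℚ)` twists every embedding to its conjugate -/
theorem twist_kap (σ : K →+* ℂ) : twist Obj.kap σ = conjugate σ :=
  RingHom.ext fun x => by
    rw [twist_apply, Obj.coe_kap, coe_liftK, NumberField.ComplexEmbedding.conjugate_coe_eq]

end Twist

section TwistCM

variable (K : CMField)

/-- the lift of the conjugate embedding `σ̄` of a CM field is `liftK σ` precomposed with complex
conjugation of `K` -/
theorem liftK_conjugate (σ : K →+* ℂ) (x : K) : liftK (conjugate σ) x = liftK σ (conjRingHomK K x) :=
  Subtype.ext (by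
    change conjugate σ x = σ (conjRingHomK K x)
    rw [NumberField.ComplexEmbedding.conjugate_coe_eq, embedding_conjRingHomK])

/-- **the twist commutes with complex conjugation** on the embeddings of a CM field (conjugation on `K` is a
field automorphism `c_K` with `σ ∘ c_K = σ̄` for every `σ`) -/
theorem twist_conjugate (γ : Gam) (σ : K →+* ℂ) : twist γ (conjugate σ) = conjugate (twist γ σ) :=
  RingHom.ext fun x => by
    rw [twist_apply, liftK_conjugate, ← twist_apply, embedding_conjRingHomK,
      NumberField.ComplexEmbedding.conjugate_coe_eq]

end TwistCM

/-! ### 3. Signs, and the embeddings of a CM field of degree `≤ 4` -/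

section Sign

variable {K : Type} [Field K]

/-- complex conjugation of embeddings is an involution -/
theorem conjugate_conjugate (φ : K →+* ℂ) : conjugate (conjugate φ) = φ :=
  NumberField.ComplexEmbedding.involutive_conjugate K φ

/-- the sign `±1` of an embedding relative to a CM type: `+1` on `Ψ`, `-1` on `Ψ̄` -/
def sgn (Ψ : CMType K) (φ : K →+* ℂ) : ℤ := by
  classical
  exact if φ ∈ Ψ.1 then 1 else -1

/-- an embedding in the CM type has sign `1` -/
theorem sgn_of_mem {Ψ : CMType K} {φ : K →+* ℂ} (h : φ ∈ Ψ.1) : sgn Ψ φ = 1 := by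
  unfold sgn; rw [if_pos h]

/-- an embedding outside the CM type has sign `-1` -/
theorem sgn_of_not_mem {Ψ : CMType K} {φ : K →+* ℂ} (h : φ ∉ Ψ.1) : sgn Ψ φ = -1 := by
  unfold sgn; rw [if_neg h]

/-- `sgn_Ψ φ = 1` iff `φ ∈ Ψ` -/
theorem sgn_eq_one_iff (Ψ : CMType K) (φ : K →+* ℂ) : sgn Ψ φ = 1 ↔ φ ∈ Ψ.1 := by
  by_cases h : φ ∈ Ψ.1
  · rw [sgn_of_mem h]; exact ⟨fun _ => h, fun _ => rfl⟩
  · rw [sgn_of_not_mem h]; exact ⟨fun h' => absurd h' (by norm_num), fun h' => absurd h' h⟩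

/-- signs are `±1` -/
theorem sgn_eq_or (Ψ : CMType K) (φ : K →+* ℂ) : sgn Ψ φ = 1 ∨ sgn Ψ φ = -1 := by
  by_cases h : φ ∈ Ψ.1
  · exact Or.inl (sgn_of_mem h)
  · exact Or.inr (sgn_of_not_mem h)

/-- conjugating an embedding flips its sign (a CM type contains exactly one of `φ, φ̄`) -/
theorem sgn_conjugate (Ψ : CMType K) (φ : K →+* ℂ) : sgn Ψ (conjugate φ) = -sgn Ψ φ := by
  by_cases h : φ ∈ Ψ.1
  · rw [sgn_of_mem h, sgn_of_not_mem ((mem_iff_conjugate_notMem Ψ φ).mp h)]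
  · rw [sgn_of_not_mem h, sgn_of_mem ((conjugate_mem_iff_notMem Ψ φ).mpr h), neg_neg]

variable [NumberField K]

/-- in a quartic field carrying a CM type, next to `x, x̄` there is a third embedding … -/
theorem exists_ne_ne_conjugate (Ψ : CMType K) (h4 : Module.finrank ℚ K = 4) (x : K →+* ℂ) :
    ∃ z : K →+* ℂ, z ≠ x ∧ z ≠ conjugate x := by
  classical
  have hx := conjugate_ne_self_of_cmType Ψ x
  by_contra h
  have hsub : (Finset.univ : Finset (K →+* ℂ)) ⊆ {x, conjugate x} := fun φ _ => by
    rw [Finset.mem_insert, Finset.mem_singleton]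
    by_contra hφ
    exact h ⟨φ, fun h1 => hφ (Or.inl h1), fun h2 => hφ (Or.inr h2)⟩
  have hcard := Finset.card_le_card hsub
  rw [Finset.card_univ, NumberField.Embeddings.card K ℂ, h4] at hcard
  rw [Finset.card_pair hx.symm] at hcard
  omega

/-- … and then `x, x̄, z, z̄` are ALL the embeddings -/
theorem eq_or_of_finrank_eq_four (Ψ : CMType K) (h4 : Module.finrank ℚ K = 4) {x z : K →+* ℂ}
    (hz : z ≠ x) (hz' : z ≠ conjugate x) (φ : K →+* ℂ) :
    φ = x ∨ φ = conjugate x ∨ φ = z ∨ φ = conjugate z := by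
  classical
  have hne := conjugate_ne_self_of_cmType Ψ
  have h1 : x ∉ ({conjugate x, z, conjugate z} : Finset (K →+* ℂ)) := by
    simp only [Finset.mem_insert, Finset.mem_singleton, not_or]
    refine ⟨(hne x).symm, fun h => hz h.symm, fun h => hz' ?_⟩
    rw [h, conjugate_conjugate]
  have h2 : conjugate x ∉ ({z, conjugate z} : Finset (K →+* ℂ)) := by
    simp only [Finset.mem_insert, Finset.mem_singleton, not_or]
    refine ⟨fun h => hz' h.symm, fun h => hz ?_⟩
    have := congrArg conjugate h
    rwa [conjugate_conjugate, conjugate_conjugate, eq_comm] at this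
  have h3 : z ∉ ({conjugate z} : Finset (K →+* ℂ)) := by
    rw [Finset.mem_singleton]; exact (hne z).symm
  have hcard : ({x, conjugate x, z, conjugate z} : Finset (K →+* ℂ)).card = 4 := by
    rw [Finset.card_insert_of_notMem h1, Finset.card_insert_of_notMem h2, Finset.card_insert_of_notMem h3,
      Finset.card_singleton]
  have huniv : ({x, conjugate x, z, conjugate z} : Finset (K →+* ℂ)) = Finset.univ :=
    Finset.eq_univ_of_card _ (by rw [hcard, NumberField.Embeddings.card K ℂ, h4])
  have hφ := Finset.mem_univ φ
  rw [← huniv] at hφ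
  simpa only [Finset.mem_insert, Finset.mem_singleton] using hφ

/-- the sum of a function over the embeddings of a quartic CM field, spelled out -/
theorem sum_univ_of_finrank_eq_four {M : Type*} [AddCommMonoid M] (Ψ : CMType K)
    (h4 : Module.finrank ℚ K = 4) {x z : K →+* ℂ} (hz : z ≠ x) (hz' : z ≠ conjugate x)
    (h : (K →+* ℂ) → M) : ∑ φ, h φ = h x + h (conjugate x) + (h z + h (conjugate z)) := by
  classical
  have hne := conjugate_ne_self_of_cmType Ψ
  have h1 : x ∉ ({conjugate x, z, conjugate z} : Finset (K →+* ℂ)) := by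
    simp only [Finset.mem_insert, Finset.mem_singleton, not_or]
    refine ⟨(hne x).symm, fun h => hz h.symm, fun h => hz' ?_⟩
    rw [h, conjugate_conjugate]
  have h2 : conjugate x ∉ ({z, conjugate z} : Finset (K →+* ℂ)) := by
    simp only [Finset.mem_insert, Finset.mem_singleton, not_or]
    refine ⟨fun h => hz' h.symm, fun h => hz ?_⟩
    have := congrArg conjugate h
    rwa [conjugate_conjugate, conjugate_conjugate, eq_comm] at this
  have h3 : z ≠ conjugate z := (hne z).symm
  have huniv : (Finset.univ : Finset (K →+* ℂ)) = {x, conjugate x, z, conjugate z} := by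
    ext φ
    simp only [Finset.mem_univ, Finset.mem_insert, Finset.mem_singleton, true_iff]
    exact eq_or_of_finrank_eq_four Ψ h4 hz hz' φ
  rw [huniv, Finset.sum_insert h1, Finset.sum_insert h2, Finset.sum_pair h3, add_assoc]

/-- in an imaginary quadratic field carrying a CM type, `x, x̄` are ALL the embeddings -/
theorem eq_or_of_finrank_eq_two (Ψ : CMType K) (h2 : Module.finrank ℚ K = 2) (x φ : K →+* ℂ) :
    φ = x ∨ φ = conjugate x := by
  classical
  have hne : x ≠ conjugate x := (conjugate_ne_self_of_cmType Ψ x).symm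
  have huniv : ({x, conjugate x} : Finset (K →+* ℂ)) = Finset.univ :=
    Finset.eq_univ_of_card _ (by rw [Finset.card_pair hne, NumberField.Embeddings.card K ℂ, h2])
  have hφ := Finset.mem_univ φ
  rw [← huniv] at hφ
  simpa only [Finset.mem_insert, Finset.mem_singleton] using hφ

/-- the sum of a function over the embeddings of an imaginary quadratic field, spelled out -/
theorem sum_univ_of_finrank_eq_two {M : Type*} [AddCommMonoid M] (Ψ : CMType K)
    (h2 : Module.finrank ℚ K = 2) (x : K →+* ℂ) (h : (K →+* ℂ) → M) :
    ∑ φ, h φ = h x + h (conjugate x) := by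
  classical
  have hne : x ≠ conjugate x := (conjugate_ne_self_of_cmType Ψ x).symm
  have huniv : (Finset.univ : Finset (K →+* ℂ)) = {x, conjugate x} := by
    ext φ
    simp only [Finset.mem_univ, Finset.mem_insert, Finset.mem_singleton, true_iff]
    exact eq_or_of_finrank_eq_two Ψ h2 x φ
  rw [huniv, Finset.sum_pair hne]

/-- the signs of a CM type add up to zero over all embeddings (any degree) -/
theorem sum_sgn_univ (Ψ : CMType K) : ∑ φ, sgn Ψ φ = 0 :=
  Finset.sum_ninvolution conjugate (fun φ => by rw [sgn_conjugate]; ring)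
    (fun φ _ => conjugate_ne_self_of_cmType Ψ φ) (fun _ => Finset.mem_univ _) conjugate_conjugate

open NumberField NumberField.InfinitePlace in
/-- a CM field of degree at most four is imaginary quadratic or quartic (a CM field is totally complex,
so its degree `= 2 · #(complex places)` is even) -/
theorem finrank_eq_two_or_eq_four_of_le_four (K : CMField) (hK : Module.finrank ℚ K ≤ 4) :
    Module.finrank ℚ K = 2 ∨ Module.finrank ℚ K = 4 := by
  have h1 := card_add_two_mul_card_eq_rank K
  have h2 : nrRealPlaces K = 0 := IsTotallyComplex.nrRealPlaces_eq_zero K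
  have h3 : 0 < Module.finrank ℚ K := Module.finrank_pos
  omega

end Sign

/-! ### 4. Sign vectors: `±1`-valued functions with extremal inner product agree (or are opposite) -/

section PlusMinus

variable {α : Type*} (S : Finset α) (u v : α → ℤ)

/-- two `±1`-valued functions that agree on `S` have inner product `#S` -/
theorem sum_mul_eq_card_of_eq (h : ∀ a ∈ S, u a = v a) (hv : ∀ a ∈ S, v a = 1 ∨ v a = -1) :
    ∑ a ∈ S, u a * v a = S.card := by
  rw [Finset.card_eq_sum_ones, Nat.cast_sum, Nat.cast_one]
  refine Finset.sum_congr rfl fun a ha => ?_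
  rw [h a ha]
  rcases hv a ha with h1 | h1 <;> rw [h1] <;> norm_num

/-- two `±1`-valued functions that are opposite on `S` have inner product `-#S` -/
theorem sum_mul_eq_neg_card_of_eq_neg (h : ∀ a ∈ S, u a = -v a) (hv : ∀ a ∈ S, v a = 1 ∨ v a = -1) :
    ∑ a ∈ S, u a * v a = -(S.card : ℤ) := by
  rw [Finset.card_eq_sum_ones, Nat.cast_sum, Nat.cast_one, ← Finset.sum_neg_distrib]
  refine Finset.sum_congr rfl fun a ha => ?_
  rw [h a ha]
  rcases hv a ha with h1 | h1 <;> rw [h1] <;> norm_num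

/-- `±1`-valued functions with inner product `#S` agree on `S` -/
theorem eq_of_sum_mul_eq_card (hu : ∀ a ∈ S, u a = 1 ∨ u a = -1) (hv : ∀ a ∈ S, v a = 1 ∨ v a = -1)
    (h : ∑ a ∈ S, u a * v a = S.card) : ∀ a ∈ S, u a = v a := by
  have hle : ∀ a ∈ S, u a * v a ≤ 1 := fun a ha => by
    rcases hu a ha with h1 | h1 <;> rcases hv a ha with h2 | h2 <;> rw [h1, h2] <;> norm_num
  rw [Finset.card_eq_sum_ones, Nat.cast_sum, Nat.cast_one] at h
  have hall := (Finset.sum_eq_sum_iff_of_le hle).mp h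
  intro a ha
  have h3 := hall a ha
  rcases hu a ha with h1 | h1 <;> rcases hv a ha with h2 | h2
  · rw [h1, h2]
  · rw [h1, h2] at h3; norm_num at h3
  · rw [h1, h2] at h3; norm_num at h3
  · rw [h1, h2]

/-- `±1`-valued functions with inner product `-#S` are opposite on `S` -/
theorem eq_neg_of_sum_mul_eq_neg_card (hu : ∀ a ∈ S, u a = 1 ∨ u a = -1)
    (hv : ∀ a ∈ S, v a = 1 ∨ v a = -1) (h : ∑ a ∈ S, u a * v a = -(S.card : ℤ)) :
    ∀ a ∈ S, u a = -v a := by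
  have hv' : ∀ a ∈ S, (fun a => -v a) a = 1 ∨ (fun a => -v a) a = -1 := fun a ha => by
    rcases hv a ha with h1 | h1 <;> simp only [h1] <;> norm_num
  refine eq_of_sum_mul_eq_card S u (fun a => -v a) hu hv' ?_
  rw [← neg_neg (S.card : ℤ), ← h, ← Finset.sum_neg_distrib]
  exact Finset.sum_congr rfl fun a _ => by ring

end PlusMinus

end HodgeCM.Toy

end
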